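import Literature.Computability.ImplicitComplexity.SoftTypeAssignmentFreeVars
import HarnessLib

/-!
# Node tables of `Λ₊` terms (first-order representation for the machine implementation)

To implement the sharing machine `STA.KAM` by a polynomial-time string function, terms are
flattened into a table of nodes in preorder: node `k` of `T` describes the subterm of `T` at
preorder position `k` — its constructor tag (`0` variable, `1` application, `2` abstraction,
`3` sum), and the absolute positions of its children (or the de Bruijn index, for a variable).
During a run of the machine every code component is a subterm of the initial term, hence a
position in this table. This file provides

* `STA.Term.nodes` — the table (with a base offset), of length `|T|` (`length_nodes`);
* `STA.Term.sub` — the subterm at a preorder position;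
* the coherence lemmas: the node at position `k` is the root node of `T.sub k`, whose children
  positions are again positions of `T` with the expected subterms (`nodes_getElem?_of_sub_app`,
  `…_lam`, `…_sum`, `…_var`), and `sub` of a closed term stays inside the table.

Folklore data-structure bookkeeping.

## References

* [GaboardiMarionRonchidellarocca2008] GMR08, §5.1 (the machine works on subterms of `M`:
  "each term occurring in 𝒜 is an instance of a subterm of M").
-/

namespace Literature.Computability.ImplicitComplexity

namespace STA

namespace Term

/-- The node table of a term in preorder, positions offset by `base`: `(tag, a, b)` with tag `0`
(variable of index `a`), `1` (application, children at `a`, `b`), `2` (abstraction, body at `a`),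
`3` (sum, branches at `a`, `b`). [folklore] -/
def nodes : Term → ℕ → List (ℕ × ℕ × ℕ)
  | .var i, _ => [(0, i, 0)]
  | .app t u, base => (1, base + 1, base + 1 + t.size) :: (t.nodes (base + 1) ++ u.nodes (base + 1 + t.size))
  | .lam t, base => (2, base + 1, 0) :: t.nodes (base + 1)
  | .sum t u, base => (3, base + 1, base + 1 + t.size) :: (t.nodes (base + 1) ++ u.nodes (base + 1 + t.size))

/-- The table has one node per symbol. [folklore] -/
@[simp] theorem length_nodes (t : Term) (base : ℕ) : (t.nodes base).length = t.size := by
  induction t generalizing base with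
  | var i => rfl
  | app t u iht ihu => simp [nodes, size, iht, ihu, Nat.add_assoc]
  | lam t ih => simp [nodes, size, ih]
  | sum t u iht ihu => simp [nodes, size, iht, ihu, Nat.add_assoc]

/-- The subterm at a preorder position. [folklore] -/
def sub : Term → ℕ → Option Term
  | t, 0 => some t
  | .var _, _ + 1 => none
  | .app t u, k + 1 => if k < t.size then t.sub k else u.sub (k - t.size)
  | .lam t, k + 1 => t.sub k
  | .sum t u, k + 1 => if k < t.size then t.sub k else u.sub (k - t.size)

/-- Position `0` is the term itself. [folklore] -/
@[simp] theorem sub_zero (t : Term) : t.sub 0 = some t := by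
  cases t <;> rfl

/-- Positions beyond the size carry no subterm. [folklore] -/
theorem sub_eq_none_of_le : ∀ (t : Term) {k : ℕ}, t.size ≤ k → t.sub k = none
  | .var i, k, h => by
    cases k with
    | zero => simp [size] at h
    | succ k => rfl
  | .app t u, k, h => by
    cases k with
    | zero => simp [size] at h
    | succ k =>
      simp only [sub, size] at h ⊢
      rw [if_neg (by omega)]
      exact sub_eq_none_of_le u (by omega)
  | .lam t, k, h => by
    cases k with
    | zero => simp [size] at h
    | succ k =>
      simp only [sub, size] at h ⊢
      exact sub_eq_none_of_le t (by omega)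
  | .sum t u, k, h => by
    cases k with
    | zero => simp [size] at h
    | succ k =>
      simp only [sub, size] at h ⊢
      rw [if_neg (by omega)]
      exact sub_eq_none_of_le u (by omega)

/-- A position carrying a subterm is inside the table. [folklore] -/
theorem lt_size_of_sub {t : Term} {k : ℕ} {X : Term} (h : t.sub k = some X) : k < t.size := by
  by_contra hk
  rw [sub_eq_none_of_le t (not_lt.1 hk)] at h
  cases h

/-- **Suffix property**: from position `k` on, the table of `T` starts with the table of `T.sub k`.
[folklore] -/
theorem nodes_drop_of_sub : ∀ (T : Term) (base : ℕ) {k : ℕ} {X : Term}, T.sub k = some X →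
    ∃ rest, (T.nodes base).drop k = X.nodes (base + k) ++ rest
  | T, base, 0, X, h => by
    simp only [sub_zero, Option.some.injEq] at h
    subst h
    exact ⟨[], by simp⟩
  | .var i, base, k + 1, X, h => by simp [sub] at h
  | .app t u, base, k + 1, X, h => by
    simp only [sub] at h
    by_cases hk : k < t.size
    · rw [if_pos hk] at h
      obtain ⟨rest, hrest⟩ := nodes_drop_of_sub t (base + 1) h
      refine ⟨rest ++ u.nodes (base + 1 + t.size), ?_⟩
      rw [nodes, List.drop_succ_cons, List.drop_append_of_le_length (by simp; omega), hrest]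
      simp [Nat.add_assoc, Nat.add_comm 1 k]
    · rw [if_neg hk] at h
      obtain ⟨rest, hrest⟩ := nodes_drop_of_sub u (base + 1 + t.size) h
      refine ⟨rest, ?_⟩
      rw [nodes, List.drop_succ_cons, List.drop_append, List.drop_eq_nil_of_le (by simp; omega),
        List.nil_append, length_nodes, hrest]
      congr 2
      omega
  | .lam t, base, k + 1, X, h => by
    simp only [sub] at h
    obtain ⟨rest, hrest⟩ := nodes_drop_of_sub t (base + 1) h
    refine ⟨rest, ?_⟩
    rw [nodes, List.drop_succ_cons, hrest]
    congr 2
    omega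
  | .sum t u, base, k + 1, X, h => by
    simp only [sub] at h
    by_cases hk : k < t.size
    · rw [if_pos hk] at h
      obtain ⟨rest, hrest⟩ := nodes_drop_of_sub t (base + 1) h
      refine ⟨rest ++ u.nodes (base + 1 + t.size), ?_⟩
      rw [nodes, List.drop_succ_cons, List.drop_append_of_le_length (by simp; omega), hrest]
      simp [Nat.add_assoc, Nat.add_comm 1 k]
    · rw [if_neg hk] at h
      obtain ⟨rest, hrest⟩ := nodes_drop_of_sub u (base + 1 + t.size) h
      refine ⟨rest, ?_⟩
      rw [nodes, List.drop_succ_cons, List.drop_append, List.drop_eq_nil_of_le (by simp; omega),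
        List.nil_append, length_nodes, hrest]
      congr 2
      omega

/-- The node at a position is the root node of the subterm there. [folklore] -/
theorem nodes_getElem?_of_sub (T : Term) (base : ℕ) {k : ℕ} {X : Term} (h : T.sub k = some X) :
    (T.nodes base)[k]? = (X.nodes (base + k)).head? := by
  obtain ⟨rest, hrest⟩ := nodes_drop_of_sub T base h
  rw [← List.head?_drop, hrest, List.head?_append]
  cases X <;> simp [nodes]

/-- Subterms of subterms are subterms, positions adding up. [folklore] -/
theorem sub_sub : ∀ (T : Term) {k j : ℕ} {X Y : Term}, T.sub k = some X → X.sub j = some Y → T.sub (k + j) = some Y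
  | T, 0, j, X, Y, h, hj => by
    simp only [sub_zero, Option.some.injEq] at h
    subst h
    simpa using hj
  | .var i, k + 1, j, X, Y, h, _ => by simp [sub] at h
  | .app t u, k + 1, j, X, Y, h, hj => by
    simp only [sub] at h
    rw [Nat.add_right_comm, sub]
    by_cases hk : k < t.size
    · rw [if_pos hk] at h
      have := sub_sub t h hj
      rw [if_pos (lt_size_of_sub this)]
      exact this
    · rw [if_neg hk] at h
      have := sub_sub u h hj
      rw [if_neg (by omega)]
      rwa [show k + j - t.size = k - t.size + j by omega]
  | .lam t, k + 1, j, X, Y, h, hj => by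
    simp only [sub] at h
    rw [Nat.add_right_comm, sub]
    exact sub_sub t h hj
  | .sum t u, k + 1, j, X, Y, h, hj => by
    simp only [sub] at h
    rw [Nat.add_right_comm, sub]
    by_cases hk : k < t.size
    · rw [if_pos hk] at h
      have := sub_sub t h hj
      rw [if_pos (lt_size_of_sub this)]
      exact this
    · rw [if_neg hk] at h
      have := sub_sub u h hj
      rw [if_neg (by omega)]
      rwa [show k + j - t.size = k - t.size + j by omega]

/-- **Coherence at an application node.** [folklore] -/
theorem table_app {T : Term} {k : ℕ} {t u : Term} (h : T.sub k = some (.app t u)) :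
    (T.nodes 0)[k]? = some (1, k + 1, k + 1 + t.size) ∧ T.sub (k + 1) = some t ∧ T.sub (k + 1 + t.size) = some u := by
  refine ⟨by rw [nodes_getElem?_of_sub T 0 h]; simp [nodes], sub_sub T h ?_, ?_⟩
  · show (Term.app t u).sub (0 + 1) = some t
    simp [sub, size_pos]
  · rw [Nat.add_assoc]
    refine sub_sub T h ?_
    show (Term.app t u).sub (1 + t.size) = some u
    rw [show 1 + t.size = (0 + t.size) + 1 by omega, sub, if_neg (by omega)]
    simp

/-- **Coherence at a sum node.** [folklore] -/
theorem table_sum {T : Term} {k : ℕ} {t u : Term} (h : T.sub k = some (.sum t u)) :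
    (T.nodes 0)[k]? = some (3, k + 1, k + 1 + t.size) ∧ T.sub (k + 1) = some t ∧ T.sub (k + 1 + t.size) = some u := by
  refine ⟨by rw [nodes_getElem?_of_sub T 0 h]; simp [nodes], sub_sub T h ?_, ?_⟩
  · show (Term.sum t u).sub (0 + 1) = some t
    simp [sub, size_pos]
  · rw [Nat.add_assoc]
    refine sub_sub T h ?_
    show (Term.sum t u).sub (1 + t.size) = some u
    rw [show 1 + t.size = (0 + t.size) + 1 by omega, sub, if_neg (by omega)]
    simp

/-- **Coherence at an abstraction node.** [folklore] -/
theorem table_lam {T : Term} {k : ℕ} {t : Term} (h : T.sub k = some (.lam t)) :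
    (T.nodes 0)[k]? = some (2, k + 1, 0) ∧ T.sub (k + 1) = some t := by
  refine ⟨by rw [nodes_getElem?_of_sub T 0 h]; simp [nodes], sub_sub T h ?_⟩
  show (Term.lam t).sub (0 + 1) = some t
  simp [sub]

/-- **Coherence at a variable node.** [folklore] -/
theorem table_var {T : Term} {k i : ℕ} (h : T.sub k = some (.var i)) : (T.nodes 0)[k]? = some (0, i, 0) := by
  rw [nodes_getElem?_of_sub T 0 h]
  simp [nodes]

end Term

end STA

end Literature.Computability.ImplicitComplexity
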